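import Summits.Schanuel.Schanuel.Theorems.ZilberEacPoleFibreExpansion
import HarnessLib

/-!
# Arbitrary base branches, LXXX(b): estimates for the fast-regime pole fibres — the split of the
# Laurent polynomial at `j = M − k`, termwise bounds, the top-term identity, growth comparisons

HONEST FRAMING.  Cell `pub-schanuel` (Zilber's Exponential-Algebraic Closedness, case ladder;
host summit Schanuel), seat 2, gen 32.  Bookkeeping lemmas for file LXXX(c)
(`unprojectedDense_branch_poleFibre_fast`): **`eval_mul_mul_split`** (the decomposition
`P(zEv) = Σ_{j<m₀} c_j(zEv)^j + Σ_{m₀≤j≤M} c_jz^jE^j + Σ_{m₀≤j≤M} c_jz^jE^j(v^j − 1)`),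
**`norm_lowSum_le`**, **`norm_corrSum_le`** (termwise bounds), **`re_top_first_order`** (the real part
of the first-order top correction: `Re(c·t·E·(X/2πi)) = t·E·(Im c/2π)·Re X` when `Re c = 0`),
and three growth comparisons along `ℓ_m → ∞`: **`eventually_mul_add_le_mul_exp`**,
**`eventually_sq_le_mul_exp`**, **`eventually_const_le_mul`**.  [folklore]; nothing here is specific
to Schanuel's conjecture (neither used nor implied); Mantova–Masser's question and EC(3,2) stay OPEN.
-/

noncomputable section

open Filter Topology Metric Complex Polynomial

set_option linter.dupNamespace false

namespace Summit.Schanuel.Schanuel.Theorems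

/-! ## Part A. Algebra: the split of `P(zEv)` -/

/-- **The split at `m₀`.**  `P(zEv) = Σ_{j<m₀} c_j(zEv)^j + Σ_{m₀≤j<N} c_j z^j E^j + Σ_{m₀≤j<N} c_j z^j E^j(v^j − 1)`
for `deg P < N`, `m₀ ≤ N`. [folklore] -/
theorem eval_mul_mul_split (P : ℂ[X]) {N m₀ : ℕ} (hN : P.natDegree < N) (hm₀ : m₀ ≤ N)
    (z E v : ℂ) :
    P.eval (z * E * v) = (∑ j ∈ Finset.range m₀, P.coeff j * (z * E * v) ^ j) +
      (∑ j ∈ Finset.Ico m₀ N, P.coeff j * z ^ j * E ^ j) +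
      ∑ j ∈ Finset.Ico m₀ N, P.coeff j * z ^ j * E ^ j * (v ^ j - 1) := by
  rw [Polynomial.eval_eq_sum_range' hN, ← Finset.sum_range_add_sum_Ico _ hm₀, add_assoc,
    ← Finset.sum_add_distrib]
  congr 1
  refine Finset.sum_congr rfl fun j _ => ?_
  ring

/-! ## Part B. Termwise bounds -/

/-- Norm of a finite sum from termwise bounds with a common factor. [folklore] -/
theorem norm_sum_le_sum_mul' {T : Finset ℕ} {f : ℕ → ℂ} {g : ℕ → ℝ} {δ : ℝ}
    (h : ∀ j ∈ T, ‖f j‖ ≤ g j * δ) : ‖∑ j ∈ T, f j‖ ≤ (∑ j ∈ T, g j) * δ := by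
  rw [Finset.sum_mul]
  exact (norm_sum_le _ _).trans (Finset.sum_le_sum h)

/-- **Low part**: `‖Σ_{j<m₀} c_j y^j‖ ≤ (Σ‖c_j‖)·B^d` for `‖y‖ ≤ B`, `1 ≤ B`, `m₀ ≤ d + 1`. [folklore] -/
theorem norm_lowSum_le (c : ℕ → ℂ) {y : ℂ} {B : ℝ} (hy : ‖y‖ ≤ B) (hB : 1 ≤ B) {m₀ d : ℕ}
    (hm₀ : m₀ ≤ d + 1) :
    ‖∑ j ∈ Finset.range m₀, c j * y ^ j‖ ≤ (∑ j ∈ Finset.range m₀, ‖c j‖) * B ^ d := by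
  refine norm_sum_le_sum_mul' fun j hj => ?_
  have hjd : j ≤ d := by have := Finset.mem_range.1 hj; omega
  rw [norm_mul, norm_pow]
  refine mul_le_mul_of_nonneg_left ?_ (norm_nonneg _)
  exact (pow_le_pow_left₀ (norm_nonneg _) hy j).trans (pow_le_pow_right₀ hB hjd)

/-- **Correction part**: `‖Σ_{j∈T} c_j z^j E^j (v^j − 1)‖ ≤ (Σ_T ‖c_j‖(‖z‖+1)^J)·(E^J·δ)` when every
`j ∈ T` has `j ≤ J` and `‖v^j − 1‖ ≤ δ`, `E ≥ 1` real. [folklore] -/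
theorem norm_corrSum_le (c : ℕ → ℂ) (z v : ℂ) {E δ : ℝ} (hE : 1 ≤ E) {T : Finset ℕ}
    {J : ℕ} (hT : ∀ j ∈ T, j ≤ J) (hv : ∀ j ∈ T, ‖v ^ j - 1‖ ≤ δ) :
    ‖∑ j ∈ T, c j * z ^ j * (E : ℂ) ^ j * (v ^ j - 1)‖ ≤
      (∑ j ∈ T, ‖c j‖ * (‖z‖ + 1) ^ J) * (E ^ J * δ) := by
  refine norm_sum_le_sum_mul' fun j hj => ?_
  have hjJ := hT j hj
  have hE0 : 0 < E := by linarith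
  rw [norm_mul, norm_mul, norm_mul, norm_pow, norm_pow, Complex.norm_real, Real.norm_eq_abs,
    abs_of_pos hE0]
  have h1 : ‖z‖ ^ j ≤ (‖z‖ + 1) ^ J :=
    (pow_le_pow_left₀ (norm_nonneg _) (by linarith [norm_nonneg z]) j).trans
      (pow_le_pow_right₀ (by linarith [norm_nonneg z]) hjJ)
  have h2 : E ^ j ≤ E ^ J := pow_le_pow_right₀ hE hjJ
  have h3 := hv j hj
  calc ‖c j‖ * ‖z‖ ^ j * E ^ j * ‖v ^ j - 1‖ ≤ ‖c j‖ * (‖z‖ + 1) ^ J * E ^ J * δ := by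
        gcongr
    _ = ‖c j‖ * (‖z‖ + 1) ^ J * (E ^ J * δ) := by ring

/-! ## Part C. The top term to first order -/

/-- **Real part of the first-order top correction.**  If `Re c = 0` then
`Re(c·t·E·(X/(2πi))) = t·E·(Im c/2π)·Re X` (`t, E` real). [folklore] -/
theorem re_top_first_order {c : ℂ} (hc : c.re = 0) (t E : ℝ) (X : ℂ) :
    (c * (t : ℂ) * (E : ℂ) * (X / (2 * Real.pi * I))).re = t * E * (c.im / (2 * Real.pi)) * X.re := by
  set τ : ℝ := c.im with hτ
  have hcI : c = (τ : ℂ) * I := Complex.ext (by simp [hc]) (by simp [hτ])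
  have hI : (I : ℂ) / (2 * Real.pi * I) = 1 / (2 * Real.pi) := by
    field_simp
  have e : c * (t : ℂ) * (E : ℂ) * (X / (2 * Real.pi * I)) =
      (((t * E * (τ / (2 * Real.pi)) : ℝ)) : ℂ) * X := by
    calc c * (t : ℂ) * (E : ℂ) * (X / (2 * Real.pi * I))
        = (τ : ℂ) * t * E * X * ((I : ℂ) / (2 * Real.pi * I)) := by rw [hcI]; ring
      _ = (τ : ℂ) * t * E * X * (1 / (2 * Real.pi)) := by rw [hI]
      _ = (((t * E * (τ / (2 * Real.pi)) : ℝ)) : ℂ) * X := by push_cast; ring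
  rw [e, Complex.re_ofReal_mul]

/-! ## Part D. Growth comparisons along `ℓ_m → ∞` -/

/-- `Aℓ + B ≤ c·e^{κℓ}` eventually (`κ, c > 0`). [folklore] -/
theorem eventually_mul_add_le_mul_exp {ℓ : ℕ → ℝ} (hℓ : Tendsto ℓ atTop atTop) {κ c : ℝ}
    (hκ : 0 < κ) (hc : 0 < c) (A B : ℝ) :
    ∀ᶠ m in atTop, A * ℓ m + B ≤ c * Real.exp (κ * ℓ m) := by
  have ht := tendsto_mul_add_div_exp hℓ hκ A B
  filter_upwards [Metric.tendsto_nhds.1 ht c hc] with m hm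
  rw [Real.dist_eq, sub_zero] at hm
  have h := (abs_lt.1 hm).2
  rw [div_lt_iff₀ (Real.exp_pos _)] at h
  exact h.le

/-- `(Aℓ + B)² ≤ c·e^{κℓ}` eventually (`κ, c > 0`). [folklore] -/
theorem eventually_sq_le_mul_exp {ℓ : ℕ → ℝ} (hℓ : Tendsto ℓ atTop atTop) {κ c : ℝ}
    (hκ : 0 < κ) (hc : 0 < c) (A B : ℝ) :
    ∀ᶠ m in atTop, (A * ℓ m + B) ^ 2 ≤ c * Real.exp (κ * ℓ m) := by
  have h := tendsto_mul_add_div_exp hℓ (half_pos hκ) A B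
  have h2 : Tendsto (fun m => (A * ℓ m + B) ^ 2 / Real.exp (κ * ℓ m)) atTop (𝓝 0) := by
    have h3 := h.mul h
    rw [mul_zero] at h3
    refine h3.congr fun m => ?_
    rw [div_mul_div_comm, ← Real.exp_add, ← pow_two]
    congr 1
    ring_nf
  filter_upwards [Metric.tendsto_nhds.1 h2 c hc] with m hm
  rw [Real.dist_eq, sub_zero] at hm
  have h4 := (abs_lt.1 hm).2
  rw [div_lt_iff₀ (Real.exp_pos _)] at h4
  exact h4.le

/-- `C ≤ c·ℓ` eventually (`c > 0`). [folklore] -/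
theorem eventually_const_le_mul {ℓ : ℕ → ℝ} (hℓ : Tendsto ℓ atTop atTop) {c : ℝ} (hc : 0 < c)
    (C : ℝ) : ∀ᶠ m in atTop, C ≤ c * ℓ m := by
  filter_upwards [hℓ.eventually (eventually_ge_atTop (C / c))] with m hm
  rwa [div_le_iff₀' hc] at hm

/-! ## Part E. The two dominance estimates of file LXXX(c) -/

/-- **Case (B): the logarithmic term dominates the error.**  With `E = e^{ℓ/k}`, `E^k·ε ≤ Aℓ + B`,
all constants nonnegative and `κ > 0`: eventually
`Clo·E^{M−k} + Cmid·E^{M−1−k}(Aℓ+B) + Cw·E^{M−k} + Cz·E^{M−k}·ε(Aℓ+B) + CR ≤ κ·E^{M−k}ℓ`. [folklore] -/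
theorem eventually_errB_le {ℓ : ℕ → ℝ} (hℓ : Tendsto ℓ atTop atTop) (hℓ0 : ∀ m, 0 ≤ ℓ m) {k M : ℕ}
    (hk : 1 ≤ k) (hkM : k < M) {E : ℕ → ℝ} (hE : ∀ m, E m = Real.exp (ℓ m / k)) {εn : ℕ → ℝ}
    (hε0 : ∀ m, 0 ≤ εn m) {A B : ℝ} (hA : 0 ≤ A) (hB : 0 ≤ B)
    (hEkε : ∀ m, E m ^ k * εn m ≤ A * ℓ m + B) (Clo Cmid Cw Cz CR : ℝ) {κ : ℝ} (hκ : 0 < κ) :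
    ∀ᶠ m in atTop, Clo * E m ^ (M - k) + Cmid * (E m ^ (M - 1 - k) * (A * ℓ m + B)) +
        Cw * E m ^ (M - k) + Cz * (E m ^ (M - k) * (εn m * (A * ℓ m + B))) + CR ≤
      κ * (E m ^ (M - k) * ℓ m) := by
  have hkR : (0 : ℝ) < k := by exact_mod_cast (show 0 < k by omega)
  have hκ4 : 0 < κ / 4 := by positivity
  have hE1 : ∀ m, 1 ≤ E m := fun m => by rw [hE]; exact Real.one_le_exp (div_nonneg (hℓ0 m) hkR.le)
  have hEk : ∀ m, E m ^ k = Real.exp (ℓ m) := fun m => by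
    rw [hE, ← Real.exp_nat_mul]; congr 1; field_simp
  have h1 := eventually_const_le_mul hℓ hκ4 (Clo + Cw)
  have h2 := eventually_mul_add_le_mul_exp hℓ (κ := 1 / k) (by positivity) hκ4 (Cmid * A) (Cmid * B)
  have h3 : ∀ᶠ m in atTop, Cz * (εn m * (A * ℓ m + B)) ≤ κ / 4 := by
    have hup : ∀ m, εn m * (A * ℓ m + B) ≤ (A * ℓ m + B) ^ 2 / Real.exp (1 * ℓ m) := by
      intro m
      rw [one_mul, ← hEk m, le_div_iff₀ (by have := hE1 m; positivity), pow_two]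
      have h0 : 0 ≤ A * ℓ m + B := by nlinarith [hℓ0 m]
      calc εn m * (A * ℓ m + B) * E m ^ k = (E m ^ k * εn m) * (A * ℓ m + B) := by ring
        _ ≤ (A * ℓ m + B) * (A * ℓ m + B) := mul_le_mul_of_nonneg_right (hEkε m) h0
    have ht : Tendsto (fun m => Cz * (εn m * (A * ℓ m + B))) atTop (𝓝 (Cz * 0)) := by
      refine tendsto_const_nhds.mul ?_
      refine squeeze_zero (fun m => by have := hℓ0 m; have := hε0 m; positivity) hup ?_
      have h := tendsto_mul_add_div_exp hℓ (half_pos one_pos) A B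
      have h' := h.mul h
      rw [mul_zero] at h'
      refine h'.congr fun m => ?_
      rw [div_mul_div_comm, ← Real.exp_add, ← pow_two]
      congr 1
      ring_nf
    rw [mul_zero] at ht
    filter_upwards [Metric.tendsto_nhds.1 ht _ hκ4] with m hm
    rw [Real.dist_eq, sub_zero] at hm
    exact (abs_lt.1 hm).2.le
  have h4 := eventually_const_le_mul hℓ hκ4 CR
  filter_upwards [h1, h2, h3, h4, hℓ.eventually (eventually_ge_atTop 1)] with m h1m h2m h3m h4m hℓ1
  have hEmk : 1 ≤ E m ^ (M - k) := one_le_pow₀ (hE1 m)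
  have hEmk0 : 0 ≤ E m ^ (M - k) := by positivity
  have hsplitE : E m ^ (M - k) = E m ^ (M - 1 - k) * Real.exp (1 / k * ℓ m) := by
    rw [show (1 : ℝ) / k * ℓ m = ℓ m / k by ring, ← hE, ← pow_succ,
      show M - 1 - k + 1 = M - k by omega]
  have i1 : Clo * E m ^ (M - k) + Cw * E m ^ (M - k) ≤ κ / 4 * (E m ^ (M - k) * ℓ m) := by
    have := mul_le_mul_of_nonneg_left h1m hEmk0
    nlinarith
  have i2 : Cmid * (E m ^ (M - 1 - k) * (A * ℓ m + B)) ≤ κ / 4 * (E m ^ (M - k) * ℓ m) := by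
    have h0 : 0 ≤ E m ^ (M - 1 - k) := by have := hE1 m; positivity
    have hh : Cmid * (A * ℓ m + B) ≤ κ / 4 * Real.exp (1 / k * ℓ m) := by nlinarith
    calc Cmid * (E m ^ (M - 1 - k) * (A * ℓ m + B)) = E m ^ (M - 1 - k) * (Cmid * (A * ℓ m + B)) := by
          ring
      _ ≤ E m ^ (M - 1 - k) * (κ / 4 * Real.exp (1 / k * ℓ m)) := mul_le_mul_of_nonneg_left hh h0
      _ = κ / 4 * E m ^ (M - k) := by rw [hsplitE]; ring
      _ ≤ κ / 4 * (E m ^ (M - k) * ℓ m) :=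
          mul_le_mul_of_nonneg_left (le_mul_of_one_le_right hEmk0 hℓ1) hκ4.le
  have i3 : Cz * (E m ^ (M - k) * (εn m * (A * ℓ m + B))) ≤ κ / 4 * (E m ^ (M - k) * ℓ m) := by
    calc Cz * (E m ^ (M - k) * (εn m * (A * ℓ m + B)))
        = E m ^ (M - k) * (Cz * (εn m * (A * ℓ m + B))) := by ring
      _ ≤ E m ^ (M - k) * (κ / 4) := mul_le_mul_of_nonneg_left h3m hEmk0
      _ ≤ E m ^ (M - k) * (κ / 4) * ℓ m := le_mul_of_one_le_right (by positivity) hℓ1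
      _ = κ / 4 * (E m ^ (M - k) * ℓ m) := by ring
  have i4 : CR ≤ κ / 4 * (E m ^ (M - k) * ℓ m) :=
    h4m.trans (mul_le_mul_of_nonneg_left (le_mul_of_one_le_left (hℓ0 m) hEmk) hκ4.le)
  linarith

/-- **Case (A): the polynomial term dominates the error.**  With `E = e^{ℓ/k}`, `d ≥ M − k + 1`, all
constants nonnegative and `c > 0`: eventually
`Clo·E^{M−k} + Chi·E^{M−k}(Aℓ+B) + CR ≤ c·E^d`. [folklore] -/
theorem eventually_errA_le {ℓ : ℕ → ℝ} (hℓ : Tendsto ℓ atTop atTop) (hℓ0 : ∀ m, 0 ≤ ℓ m) {k M d : ℕ}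
    (hk : 1 ≤ k) (hd : M - k + 1 ≤ d) {E : ℕ → ℝ} (hE : ∀ m, E m = Real.exp (ℓ m / k))
    (A B Clo Chi : ℝ) {CR c : ℝ} (hCR : 0 ≤ CR) (hc : 0 < c) :
    ∀ᶠ m in atTop, Clo * E m ^ (M - k) + Chi * (E m ^ (M - k) * (A * ℓ m + B)) + CR ≤ c * E m ^ d := by
  have hkR : (0 : ℝ) < k := by exact_mod_cast (show 0 < k by omega)
  have hE1 : ∀ m, 1 ≤ E m := fun m => by rw [hE]; exact Real.one_le_exp (div_nonneg (hℓ0 m) hkR.le)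
  set e₁ : ℕ := d - (M - k) with he₁
  have he₁1 : 1 ≤ e₁ := by omega
  have hde : d = M - k + e₁ := by omega
  have hκ : (0 : ℝ) < (e₁ : ℝ) / k := by
    have : (1 : ℝ) ≤ e₁ := by exact_mod_cast he₁1
    positivity
  have h := eventually_mul_add_le_mul_exp hℓ hκ hc (Chi * A) (Clo + Chi * B + CR)
  filter_upwards [h] with m hm
  have hEe : Real.exp ((e₁ : ℝ) / k * ℓ m) = E m ^ e₁ := by
    rw [hE, ← Real.exp_nat_mul]; congr 1; ring
  rw [hEe] at hm
  have h0 : 0 ≤ E m ^ (M - k) := by have := hE1 m; positivity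
  have h1 : 1 ≤ E m ^ (M - k) := one_le_pow₀ (hE1 m)
  calc Clo * E m ^ (M - k) + Chi * (E m ^ (M - k) * (A * ℓ m + B)) + CR
      ≤ Clo * E m ^ (M - k) + Chi * (E m ^ (M - k) * (A * ℓ m + B)) + CR * E m ^ (M - k) := by
        nlinarith
    _ = E m ^ (M - k) * (Chi * A * ℓ m + (Clo + Chi * B + CR)) := by ring
    _ ≤ E m ^ (M - k) * (c * E m ^ e₁) := mul_le_mul_of_nonneg_left hm h0
    _ = c * E m ^ d := by rw [hde, pow_add]; ring

/-! ## Part F. Small packaged facts for file LXXX(c) -/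

/-- First-order bound for the powers of the unit factor, packaged: `‖ε‖ ≤ 1/(3M)`, `j ≤ M`, `k ≥ 1`
⟹ `‖exp((j/k)log(1+ε)) − 1‖ ≤ 3M‖ε‖`. [folklore] -/
theorem norm_unitPow_sub_one_le {ε : ℂ} {k M j : ℕ} (hk : 1 ≤ k) (hM : 1 ≤ M) (hj : j ≤ M)
    (hε : ‖ε‖ ≤ 1 / (3 * M)) :
    ‖Complex.exp ((((j : ℝ) / k : ℝ) : ℂ) * Complex.log (1 + ε)) - 1‖ ≤ 3 * M * ‖ε‖ := by
  have hMR : (1 : ℝ) ≤ M := by exact_mod_cast hM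
  have hk1 : (1 : ℝ) ≤ k := by exact_mod_cast hk
  have hjR : (j : ℝ) ≤ M := by exact_mod_cast hj
  have ht0 : (0 : ℝ) ≤ (j : ℝ) / k := by positivity
  have htM : (j : ℝ) / k ≤ M := (div_le_self (by positivity) hk1).trans hjR
  have hε2 : ‖ε‖ ≤ 1 / 2 :=
    hε.trans (by rw [div_le_div_iff₀ (by positivity) two_pos]; linarith)
  have hM0 : (M : ℝ) ≠ 0 := by positivity
  have htε : 3 / 2 * ((j : ℝ) / k) * ‖ε‖ ≤ 1 := by
    calc 3 / 2 * ((j : ℝ) / k) * ‖ε‖ ≤ 3 / 2 * M * (1 / (3 * M)) := by gcongr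
      _ = 1 / 2 := by field_simp
      _ ≤ 1 := by norm_num
  calc ‖Complex.exp ((((j : ℝ) / k : ℝ) : ℂ) * Complex.log (1 + ε)) - 1‖
      ≤ 3 * ((j : ℝ) / k) * ‖ε‖ := norm_exp_mul_log_one_add_sub_one_le ht0 hε2 htε
    _ ≤ 3 * M * ‖ε‖ := by gcongr

/-- Second-order bound for the top power of the unit factor, packaged: `‖ε‖ ≤ 1/(3M)`, `k ≥ 1`
⟹ `‖exp((M/k)log(1+ε)) − 1 − (M/k)ε‖ ≤ (3(M/k)² + M/k)‖ε‖²`. [folklore] -/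
theorem norm_unitPowTop_sub_sub_le {ε : ℂ} {k M : ℕ} (hk : 1 ≤ k) (hM : 1 ≤ M)
    (hε : ‖ε‖ ≤ 1 / (3 * M)) :
    ‖Complex.exp ((((M : ℝ) / k : ℝ) : ℂ) * Complex.log (1 + ε)) - 1 - (((M : ℝ) / k : ℝ) : ℂ) * ε‖ ≤
      (3 * ((M : ℝ) / k) ^ 2 + (M : ℝ) / k) * ‖ε‖ ^ 2 := by
  have hMR : (1 : ℝ) ≤ M := by exact_mod_cast hM
  have hk1 : (1 : ℝ) ≤ k := by exact_mod_cast hk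
  have ht0 : (0 : ℝ) ≤ (M : ℝ) / k := by positivity
  have htM : (M : ℝ) / k ≤ M := div_le_self (by positivity) hk1
  have hε2 : ‖ε‖ ≤ 1 / 2 :=
    hε.trans (by rw [div_le_div_iff₀ (by positivity) two_pos]; linarith)
  have hM0 : (M : ℝ) ≠ 0 := by positivity
  have htε : 3 / 2 * ((M : ℝ) / k) * ‖ε‖ ≤ 1 := by
    calc 3 / 2 * ((M : ℝ) / k) * ‖ε‖ ≤ 3 / 2 * M * (1 / (3 * M)) := by gcongr
      _ = 1 / 2 := by field_simp
      _ ≤ 1 := by norm_num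
  exact norm_exp_mul_log_one_add_sub_sub_le ht0 hε2 htε

/-- The absolute-value bookkeeping of case (B):
`|(a + 0 + (b + (K + (c + d))) + e) − K| ≤ |a|+|b|+|c|+|d|+|e|`. [folklore] -/
theorem abs_caseB_le (a b c d e K : ℝ) :
    |a + 0 + (b + (K + (c + d))) + e - K| ≤ |a| + |b| + |c| + |d| + |e| := by
  have h : a + 0 + (b + (K + (c + d))) + e - K = a + b + c + d + e := by ring
  rw [h]
  have t1 := abs_add_le (a + b + c + d) e
  have t2 := abs_add_le (a + b + c) d
  have t3 := abs_add_le (a + b) c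
  have t4 := abs_add_le a b
  linarith

/-- The absolute-value bookkeeping of case (A): `|g| − (|a| + |c| + |e|) ≤ |a + g + c + e|`. [folklore] -/
theorem abs_caseA_le (a g c e : ℝ) : |g| - (|a| + |c| + |e|) ≤ |a + g + c + e| := by
  have h := abs_sub_abs_le_abs_sub g (-(a + c + e))
  have e1 : g - -(a + c + e) = a + g + c + e := by ring
  rw [e1, abs_neg] at h
  have t1 := abs_add_le (a + c) e
  have t2 := abs_add_le a c
  linarith

/-! ## Part G. Rescaled bounds used verbatim in file LXXX(c) -/

/-- **Low part, rescaled**: with `‖v‖ ≤ 2`, `E ≥ 1`: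
`‖Σ_{j<m₀} c_j (zEv)^j‖ ≤ ((Σ‖c_j‖)(2‖z‖+1)^{d})·E^{d}` (`m₀ ≤ d + 1`). [folklore] -/
theorem norm_lowSum_le' (c : ℕ → ℂ) (z v : ℂ) {E : ℝ} (hE : 1 ≤ E) (hv : ‖v‖ ≤ 2) {m₀ d : ℕ}
    (hm₀ : m₀ ≤ d + 1) :
    ‖∑ j ∈ Finset.range m₀, c j * (z * (E : ℂ) * v) ^ j‖ ≤
      (∑ j ∈ Finset.range m₀, ‖c j‖) * (2 * ‖z‖ + 1) ^ d * E ^ d := by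
  have hE0 : 0 < E := by linarith
  have hy : ‖z * (E : ℂ) * v‖ ≤ (2 * ‖z‖ + 1) * E := by
    rw [norm_mul, norm_mul, Complex.norm_real, Real.norm_eq_abs, abs_of_pos hE0]
    have h1 : ‖z‖ * E * ‖v‖ ≤ ‖z‖ * E * 2 := mul_le_mul_of_nonneg_left hv (by positivity)
    nlinarith [norm_nonneg z]
  have hy1 : 1 ≤ (2 * ‖z‖ + 1) * E := by nlinarith [norm_nonneg z]
  have h := norm_lowSum_le c hy hy1 hm₀
  rwa [mul_pow, ← mul_assoc] at h

/-- **Correction part, rescaled**: from the termwise first-order bounds and `E^k·ε ≤ Aℓ + B`,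
`‖Σ_{j∈T} c_j z^j E^j (v^j − 1)‖ ≤ ((Σ_T ‖c_j‖(‖z‖+1)^J)·3M)·(E^{J−k}(Aℓ+B))` (`k ≤ J`). [folklore] -/
theorem norm_corrSum_le' (c : ℕ → ℂ) (z v : ℂ) {E εn A B ℓ : ℝ} (hE : 1 ≤ E) {T : Finset ℕ}
    {J k M : ℕ} (hkJ : k ≤ J) (hT : ∀ j ∈ T, j ≤ J) (hv : ∀ j ∈ T, ‖v ^ j - 1‖ ≤ 3 * M * εn)
    (hEkε : E ^ k * εn ≤ A * ℓ + B) :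
    ‖∑ j ∈ T, c j * z ^ j * (E : ℂ) ^ j * (v ^ j - 1)‖ ≤
      (∑ j ∈ T, ‖c j‖ * (‖z‖ + 1) ^ J) * (3 * M) * (E ^ (J - k) * (A * ℓ + B)) := by
  refine (norm_corrSum_le c z v hE hT hv).trans ?_
  have e1 : E ^ J * (3 * M * εn) = 3 * M * (E ^ (J - k) * (E ^ k * εn)) := by
    rw [← mul_assoc (E ^ (J - k)), ← pow_add, Nat.sub_add_cancel hkJ]; ring
  rw [e1]
  have h0 : 0 ≤ E ^ (J - k) := by have : 0 < E := by linarith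
                                  positivity
  have h2 : E ^ (J - k) * (E ^ k * εn) ≤ E ^ (J - k) * (A * ℓ + B) :=
    mul_le_mul_of_nonneg_left hEkε h0
  have h4 : 0 ≤ (∑ j ∈ T, ‖c j‖ * (‖z‖ + 1) ^ J) * (3 * M) := by positivity
  calc (∑ j ∈ T, ‖c j‖ * (‖z‖ + 1) ^ J) * (3 * M * (E ^ (J - k) * (E ^ k * εn)))
      = (∑ j ∈ T, ‖c j‖ * (‖z‖ + 1) ^ J) * (3 * M) * (E ^ (J - k) * (E ^ k * εn)) := by ring
    _ ≤ (∑ j ∈ T, ‖c j‖ * (‖z‖ + 1) ^ J) * (3 * M) * (E ^ (J - k) * (A * ℓ + B)) :=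
        mul_le_mul_of_nonneg_left h2 h4

/-- **The size of `x₁` along the points**: `‖Φ(s)·(s^M)⁻¹‖ ≤ e^{(M/k + 1)ℓ}` once
`(‖Φ(s)‖)·(2‖z‖)^M ≤ e^ℓ`, with `s⁻¹ = zEv`, `‖v‖ ≤ 2`, `E^M = e^{M(ℓ/k)}`. [folklore] -/
theorem norm_place_coordinate_le {Φs s z v : ℂ} {E ℓ : ℝ} {M k : ℕ} (hE0 : 0 < E)
    (hsinv : s⁻¹ = z * (E : ℂ) * v) (hv : ‖v‖ ≤ 2) (hEM : E ^ M = Real.exp ((M : ℝ) * (ℓ / k)))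
    {CΦ : ℝ} (hΦ : ‖Φs‖ ≤ CΦ) (hbig : CΦ * (‖z‖ * 2) ^ M ≤ Real.exp ℓ) :
    ‖Φs * (s ^ M)⁻¹‖ ≤ Real.exp (((M : ℝ) / k + 1) * ℓ) := by
  have hx0 : ‖(s ^ M)⁻¹‖ ≤ (‖z‖ * 2) ^ M * Real.exp ((M : ℝ) / k * ℓ) := by
    rw [← inv_pow, hsinv, norm_pow, norm_mul, norm_mul, Complex.norm_real, Real.norm_eq_abs,
      abs_of_pos hE0, show (M : ℝ) / k * ℓ = (M : ℝ) * (ℓ / k) by ring, ← hEM, ← mul_pow]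
    refine pow_le_pow_left₀ (by positivity) ?_ M
    calc ‖z‖ * E * ‖v‖ ≤ ‖z‖ * E * 2 := mul_le_mul_of_nonneg_left hv (by positivity)
      _ = ‖z‖ * 2 * E := by ring
  have hCΦ : 0 ≤ CΦ := (norm_nonneg _).trans hΦ
  rw [norm_mul, add_mul, one_mul, Real.exp_add]
  calc ‖Φs‖ * ‖(s ^ M)⁻¹‖ ≤ CΦ * ((‖z‖ * 2) ^ M * Real.exp ((M : ℝ) / k * ℓ)) :=
        mul_le_mul hΦ hx0 (norm_nonneg _) hCΦ
    _ = Real.exp ((M : ℝ) / k * ℓ) * (CΦ * (‖z‖ * 2) ^ M) := by ring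
    _ ≤ Real.exp ((M : ℝ) / k * ℓ) * Real.exp ℓ := mul_le_mul_of_nonneg_left hbig (Real.exp_pos _).le

end Summit.Schanuel.Schanuel.Theorems

end
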